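import Summits.BirchSwinnertonDyer.BirchSwinnertonDyer.Theorems.SemiOrdinaryEisensteinDescentWildKolyvaginUpperAtThreeTowerFree
import Summits.BirchSwinnertonDyer.BirchSwinnertonDyer.Theorems.SemiOrdinaryEisensteinDescentEisensteinKernelAtThreeTowerFree
import HarnessLib

/-!
# Route `SemiOrdinaryEisensteinDescent`: the leaf `WAllExclAddWildRankOneSurj` — and the residual crux NT
# `WildRankOneSurjNonTowerAtThree` (stmt-BirchSwinnertonDyer-20484) — from J′ (J with its `TowerSurjThree`
# binder deleted) + E′ + V + C + Z + published inputs + {Cassels–Tate level inputs, Gross 3.7 (2), GZ86 III (3.1)},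
# with NEITHER the Kolyvagin crux Ko NOR the non-tower residual NT as an input
# (width seat `bsd-wall-soed-p2-w2` g3 on crux Ko stmt-BirchSwinnertonDyer-20480; `--supports 20480`, helper)

The two-line composition of this seat's files: `…WildKolyvaginUpperAtThreeTowerFree` (Ko′ ⟸ J′ + three primitives:
the McCallum road consumes only the mod-`3` image) and `…EisensteinKernelAtThreeTowerFree` (leaf ⟸ PUB + E′ + Ko′ +
V + C + Z, kernel re-run with no tower split). READING FOR THE PEN: with Ko ↦ Ko′ and J ↦ J′ (delete the binder
`Summit.BirchSwinnertonDyer.Rank1Residual.AdditiveThree.TowerSurjThree W →` from items 20480 / 20760) the route's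
`closes` needs no NT socket: the onto-mod-`3`/not-onto-mod-`9` rows (Elkies) are paid by the same chain. In print
this is as it should be: McCallum 1991 §3 works at level `p^M` under «`Gal(ℚ(E_p)/ℚ) = GL₂(ℤ/pℤ)`» only (first
paragraph of §3), and the tree's kernel derivation of his Cor. 5.6 agrees. CONDITIONAL theorems: J′ (Σ-form
refined Kolyvagin divisibility at the additive prime `3`, Manin-robust — OPEN, the wall of crux J), E′, V, C, Z and
the three named facts are antecedents; BSD is not proved for any curve; no definition, no named fact, no `sorry`.

References: [McCallumLMS1991] §3 (first paragraph), §5 Cor. 5.6; [JetchevSkinnerWan2017] §7.4.1;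
[GrossLMS1991] Prop. 3.7 (2), §6, Prop. 9.1; [GrossZagier1986] III (3.1); [MilneADT2006] I §6; [Jetchev2008]
Conj. 1.3.
-/

noncomputable section

open scoped Classical

set_option linter.dupNamespace false -- `Summit.BirchSwinnertonDyer.BirchSwinnertonDyer.Theorems.…` (summit = sub)
set_option autoImplicit false

namespace Summit.BirchSwinnertonDyer.BirchSwinnertonDyer.Theorems.EisensteinKernelAtThreeTowerFree

open WeierstrassCurve NumberField
  Literature.NumberTheory.EllipticCurves
  Literature.NumberTheory.EllipticCurves.ModularForms
  Summit.BirchSwinnertonDyer.Rank1Residual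
  Summit.BirchSwinnertonDyer.Rank1Residual.Additive
  Summit.BirchSwinnertonDyer.Rank1Residual.X11b
  Summit.BirchSwinnertonDyer.Rank1Residual.X11b.Three
  Summit.BirchSwinnertonDyer.BirchSwinnertonDyer.Theses.SemiOrdinaryEisensteinDescent
  Summit.BirchSwinnertonDyer.BirchSwinnertonDyer.Theorems
  Summit.BirchSwinnertonDyer.BirchSwinnertonDyer.Theorems.WildKolyvaginUpperAtThreeTowerFree

/-- **SOED's leaf with NEITHER Ko NOR NT as input**: `PublishedInputsWildThree →
WildSplitEisensteinInclusionAtThreeRestricted → J′ → WildSplitWaldspurgerAtThree → WildSplitControlAtThree →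
WildRankZeroTwistAtThree → (∀ K, casselsTate_levelInputs K) → prop37_2_frobeniusCongruence →
Gross1991_heegnerPoint_sub_ratTorsion_mem_E0 → WAllExclAddWildRankOneSurj`, where `hJ'` is crux J
`WildSigmaDivisibilityAtThree` (stmt-20760) VERBATIM with its binder `AdditiveThree.TowerSurjThree W →` DELETED.
= `wAllExclAddWildRankOneSurj_of_koTowerFree` ∘ `koTowerFree_of_sigmaTowerFree_of_threePrimitives`. Every research
input is an antecedent; BSD is not proved by this. [cite: McCallumLMS1991, §3 (first paragraph) and §5 Cor. 5.6 (p. 310)]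
[cite: JetchevSkinnerWan2017, §7.4.1 (arXiv:1512.06894 p. 30)] [cite: Jetchev2008, Conj. 1.3 (p. 812)] -/
theorem wAllExclAddWildRankOneSurj_of_sigmaTowerFree_of_threePrimitives (hF : PublishedInputsWildThree)
    (hE' : WildSplitEisensteinInclusionAtThreeRestricted)
    (hJ' : ∀ (W : WeierstrassCurve ℚ) [W.IsElliptic] [W.IsGloballyMinimal] (N : ℕ) [NeZero N] (K : Type)
      [Field K] [NumberField K] (Dt : ModularParametrizationData W N)
      (H : HeegnerDatum N (NumberField.discr K)) (ι : K →+* ℂ) (P : (W.baseChange K).toAffine.Point),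
      ClassO6 W 3 → W.HasSurjectiveModNGaloisRep 3 → W.analyticRank = 1 → W.conductorNorm ℤ = N →
      IsImaginaryQuadratic K → SatisfiesHeegnerHypothesis N K →
      (W.quadraticTwist (NumberField.discr K : ℚ)).entireLFunction 1 ≠ 0 →
      WeierstrassCurve.Affine.Point.map ι.toRatAlgHom P = heegnerPointComplex Dt H →
      ¬ IsOfFinAddOrder P → Odd (NumberField.discr K) → NumberField.discr K ≠ -3 →
      ∀ (s' : ℕ), s' ≤ padicValNat 3 W.tamagawaProduct + padicValNat 3 Dt.c.natAbs →
        ∀ (n : ℕ) (d : KolyvaginHeegnerData Dt H.β ι n), Squarefree n →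
          (∀ ℓ ∈ n.primeFactors, Zhang2014.IsKolyvaginPrime N W K 3 ℓ ∧
            s' ≤ Zhang2014.kolyvaginIndex W 3 ℓ) → Koly.PDiv d 3 s')
    (hV : WildSplitWaldspurgerAtThree) (hC : WildSplitControlAtThree) (hZ : WildRankZeroTwistAtThree)
    (hCT : ∀ (K : Type) [Field K] [NumberField K], casselsTate_levelInputs K)
    (h372 : GrossLMS1991.prop37_2_frobeniusCongruence) (hE0 : Gross1991_heegnerPoint_sub_ratTorsion_mem_E0) :
    Summit.BirchSwinnertonDyer.WAllExclAddWildRankOneSurj :=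
  wAllExclAddWildRankOneSurj_of_koTowerFree hF hE' (koTowerFree_of_sigmaTowerFree_of_threePrimitives hCT h372 hE0 hJ')
    hV hC hZ

/-- **The residual crux NT `WildRankOneSurjNonTowerAtThree` (stmt-BirchSwinnertonDyer-20484) BY NAME from J′ + E′ +
V + C + Z + published inputs + the three primitives** — no input mentions the `3`-adic tower; the rows «onto mod
`3`, not onto mod `9`» cost nothing beyond the tower rows. Every research input is an antecedent; BSD is not
proved by this. [cite: McCallumLMS1991, §3 (first paragraph) and §5 Cor. 5.6 (p. 310)]
[cite: JetchevSkinnerWan2017, §7.4.1 (arXiv:1512.06894 p. 30)] -/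
theorem wildRankOneSurjNonTowerAtThree_of_sigmaTowerFree_of_threePrimitives (hF : PublishedInputsWildThree)
    (hE' : WildSplitEisensteinInclusionAtThreeRestricted)
    (hJ' : ∀ (W : WeierstrassCurve ℚ) [W.IsElliptic] [W.IsGloballyMinimal] (N : ℕ) [NeZero N] (K : Type)
      [Field K] [NumberField K] (Dt : ModularParametrizationData W N)
      (H : HeegnerDatum N (NumberField.discr K)) (ι : K →+* ℂ) (P : (W.baseChange K).toAffine.Point),
      ClassO6 W 3 → W.HasSurjectiveModNGaloisRep 3 → W.analyticRank = 1 → W.conductorNorm ℤ = N →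
      IsImaginaryQuadratic K → SatisfiesHeegnerHypothesis N K →
      (W.quadraticTwist (NumberField.discr K : ℚ)).entireLFunction 1 ≠ 0 →
      WeierstrassCurve.Affine.Point.map ι.toRatAlgHom P = heegnerPointComplex Dt H →
      ¬ IsOfFinAddOrder P → Odd (NumberField.discr K) → NumberField.discr K ≠ -3 →
      ∀ (s' : ℕ), s' ≤ padicValNat 3 W.tamagawaProduct + padicValNat 3 Dt.c.natAbs →
        ∀ (n : ℕ) (d : KolyvaginHeegnerData Dt H.β ι n), Squarefree n →
          (∀ ℓ ∈ n.primeFactors, Zhang2014.IsKolyvaginPrime N W K 3 ℓ ∧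
            s' ≤ Zhang2014.kolyvaginIndex W 3 ℓ) → Koly.PDiv d 3 s')
    (hV : WildSplitWaldspurgerAtThree) (hC : WildSplitControlAtThree) (hZ : WildRankZeroTwistAtThree)
    (hCT : ∀ (K : Type) [Field K] [NumberField K], casselsTate_levelInputs K)
    (h372 : GrossLMS1991.prop37_2_frobeniusCongruence) (hE0 : Gross1991_heegnerPoint_sub_ratTorsion_mem_E0) :
    WildRankOneSurjNonTowerAtThree :=
  wildRankOneSurjNonTowerAtThree_of_koTowerFree hF hE'
    (koTowerFree_of_sigmaTowerFree_of_threePrimitives hCT h372 hE0 hJ') hV hC hZ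

end Summit.BirchSwinnertonDyer.BirchSwinnertonDyer.Theorems.EisensteinKernelAtThreeTowerFree

end
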